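import Summits.NavierStokesRegularity.NavierStokesRegularity.Theorems.BoundedTemperatureClosed.Negative.TemperatureFloor
import Literature.Analysis.FluidPDE.SelfSimilar
import Literature.Analysis.FluidPDE.AncientMildDrift

/-!
# Crux `BoundedTemperatureClosed` (stmt-NavierStokesRegularity-18303), negative side:
# KNSS parasitic drifts kill the `θ = 1` stubs of the round-1 `k = 2` idea cards AS TYPED (crux triage r1-1)

Planner/ideator-facing small-model facts (refuter, crux-triage panel round 1, triager 1). The two
Navier–Stokes-side hard stubs typed in `Cruxes/BoundedTemperatureClosed/SketchIdeator2.lean` —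
`IgnitionWithLossNS` (card `closed-shadow`: "every nontrivial smooth ancient mild solution with Type-I time
decay `M` can be re-ignited from Schwartz data with `η` loss") and `HeteroclinicRigidityNS` (card
`recycle-track-shoot`: "an ancient mild Type-I solution emanating from another is a symmetry image of it") —
quantify over the class `IsAncientMildSolution 1 U ∧ (U smooth on t < 0) ∧ HasTypeITimeDecay M U ∧ U ≢ 0`.
That class contains the PARASITIC DRIFTS `U(t, x) = b(t)` of Koch–Nadirashvili–Seregin–Šverák (in tree:
`Literature.Analysis.FluidPDE.isAncientMildSolution_timeConst`) at every positive temperature, and they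
refute both stubs unconditionally:

* `not_ignitionWithLossNS` — igniting the cold drift `(c/4)(−t)^{-1/2} e₀` with loss `η = c/4` would give a
  Schwartz-data `H¹⁰_df`-mild Navier–Stokes Type-I blow-up of ceiling `c/2 < c`, against the landed
  temperature floor `typeI_constant_ge` (Leray 1934 in Tao's mild class, `TemperatureFloor.lean`).
* `not_heteroclinicRigidityNS` — `U = (−t)^{-1/2} e₀`, `W = (−t)^{-1/2} e₀ + (1−t)^{-1/2} e₁`, `M = 2`,
  `c_k = 1/(k+1)`: `c_k W(c_k² t, c_k x) → U` uniformly on `t < 0`, yet `W` has an `e₁`-component, so it is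
  no `γ U(γ² t + τ, γ x + a)`.

Classification: stub-misstated (junk model), repair = space–time Type-I decay `HasTypeIDecay M U`
(`‖U(t,x)‖ ≤ M/(‖x‖ + √(−t))`, KNSS (1.6)) or KNSS's bounded/Oseen-kernel class modulo parasitic solutions;
both witnesses miss the repair (`drift` is not Type-I in space). The point for round 2 / the AtOne
restatement is not cosmetic: these cards take zoom limits under an `L^∞`-in-time ceiling only, the regime in
which drift-dressed limit objects do occur (ideator-2 notes BN1/BN2), so the object class of any
"shadow"/"exit" stub must carry spatial Type-I decay explicitly.

Statement shapes are local notations (no new `Prop` definitions); the two bodies are copied VERBATIM from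
`SketchIdeator2.lean`.

## References

* G. Koch, N. Nadirashvili, G. Seregin, V. Šverák, Acta Math. 203 (2009), arXiv:0709.3599, §1 p. 3
  (parasitic solutions `u(x,t) = b(t)`), (1.4), (1.6). [`KochNadirashviliSereginSverak2009`]
* J. Leray, Acta Math. 63 (1934), §19 (3.9). [`Leray1934`]
-/

noncomputable section

-- the nested summit namespace `…NavierStokesRegularity.NavierStokesRegularity…` is the tree's layout (D-0017)
set_option linter.dupNamespace false

namespace Summit.NavierStokesRegularity.NavierStokesRegularity.Theorems.BoundedTemperatureClosed.Negative

open MeasureTheory Set Filter Topology Function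
open scoped ENNReal
open Literature.Analysis.FluidPDE Literature.Analysis.FluidPDE.Tao2016

/-- Card `recycle-track-shoot`'s codimension-0 exit stub at `θ = 1` (`HeteroclinicRigidityNS` of
`SketchIdeator2.lean`, verbatim body). -/
local notation3 "heteroclinicRigidityNS" =>
  ∀ (M : ℝ) (U W : ℝ → EuclideanSpace ℝ (Fin 3) → EuclideanSpace ℝ (Fin 3)),
    Literature.Analysis.FluidPDE.IsAncientMildSolution 1 U →
    Literature.Analysis.FluidPDE.IsAncientMildSolution 1 W →
    ContDiffOn ℝ (⊤ : ℕ∞) (Function.uncurry U) (Set.Iio 0 ×ˢ Set.univ) →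
    ContDiffOn ℝ (⊤ : ℕ∞) (Function.uncurry W) (Set.Iio 0 ×ˢ Set.univ) →
    Literature.Analysis.FluidPDE.HasTypeITimeDecay M U →
    Literature.Analysis.FluidPDE.HasTypeITimeDecay M W →
    (¬ ∀ t < 0, ∀ x, U t x = 0) →
    (∃ c : ℕ → ℝ, (∀ k, 0 < c k) ∧ Filter.Tendsto c Filter.atTop (nhds 0) ∧
      ∀ K : Set (ℝ × EuclideanSpace ℝ (Fin 3)), IsCompact K → K ⊆ Set.Iio 0 ×ˢ Set.univ →
        TendstoUniformlyOn (fun k z => Literature.Analysis.FluidPDE.nsRescale (c k) W z.1 z.2)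
          (Function.uncurry U) Filter.atTop K) →
    ∃ (a : EuclideanSpace ℝ (Fin 3)) (τ γ : ℝ), 0 < γ ∧ ∀ t : ℝ, ∀ x : EuclideanSpace ℝ (Fin 3),
      γ ^ 2 * t + τ < 0 → W t x = γ • U (γ ^ 2 * t + τ) (γ • x + a)

/-- Card `closed-shadow`'s transferred stub at `θ = 1` (`IgnitionWithLossNS` of `SketchIdeator2.lean`,
verbatim body). -/
local notation3 "ignitionWithLossNS" =>
  ∀ (M : ℝ) (U : ℝ → EuclideanSpace ℝ (Fin 3) → EuclideanSpace ℝ (Fin 3)),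
    Literature.Analysis.FluidPDE.IsAncientMildSolution 1 U →
    ContDiffOn ℝ (⊤ : ℕ∞) (Function.uncurry U) (Set.Iio 0 ×ˢ Set.univ) →
    Literature.Analysis.FluidPDE.HasTypeITimeDecay M U →
    (¬ ∀ t < 0, ∀ x, U t x = 0) → ∀ η : ℝ, 0 < η →
    ∃ u₀ : SchwartzMap (EuclideanSpace ℝ (Fin 3)) (EuclideanSpace ℝ (Fin 3)),
      Literature.Analysis.FluidPDE.VectorCalculus.IsDivFree ⇑u₀ ∧ ∃ S : ℝ, 0 < S ∧
      ∃ u : ℝ → Literature.Analysis.FluidPDE.Tao2016.L2C,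
        Literature.Analysis.FluidPDE.Tao2016.IsMildSolutionFor Literature.Analysis.FluidPDE.Tao2016.eulerForm
          (Literature.Analysis.FluidPDE.Tao2016.schwartzL2 u₀) (Set.Ico 0 S) u ∧
        (∀ t ∈ Set.Ico 0 S, MeasureTheory.eLpNorm (u t) ⊤ MeasureTheory.volume ≤
          ENNReal.ofReal ((M + η) / Real.sqrt (S - t))) ∧
        ¬ ∃ S' : ℝ, S < S' ∧ ∃ v : ℝ → Literature.Analysis.FluidPDE.Tao2016.L2C,
          Literature.Analysis.FluidPDE.Tao2016.IsMildSolutionFor Literature.Analysis.FluidPDE.Tao2016.eulerForm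
            (Literature.Analysis.FluidPDE.Tao2016.schwartzL2 u₀) (Set.Ico 0 S') v ∧
          ∀ t ∈ Set.Ico 0 S, v t = u t

namespace ParasiticDrift

/-- The unit vectors `e₀ = (1,0,0)`, `e₁ = (0,1,0)` (local abbreviations). -/
local notation "e₀" => (EuclideanSpace.single (0 : Fin 3) (1 : ℝ) : EuclideanSpace ℝ (Fin 3))
local notation "e₁" => (EuclideanSpace.single (1 : Fin 3) (1 : ℝ) : EuclideanSpace ℝ (Fin 3))

/-- KNSS's parasitic drift at temperature `a`: `(a/√(−t)) e₀` (junk `0` for `t ≥ 0`).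
[cite: KochNadirashviliSereginSverak2009, §1 p. 3 (parasitic solutions u(x,t) = b(t))] -/
def sdrift (a : ℝ) : ℝ → EuclideanSpace ℝ (Fin 3) → EuclideanSpace ℝ (Fin 3) := fun t _ => (a * (Real.sqrt (-t))⁻¹) • e₀

/-- The perturbed drift `(−t)^{-1/2} e₀ + (1−t)^{-1/2} e₁`.
[cite: KochNadirashviliSereginSverak2009, §1 p. 3 (parasitic solutions u(x,t) = b(t))] -/
def pdrift : ℝ → EuclideanSpace ℝ (Fin 3) → EuclideanSpace ℝ (Fin 3) := fun t _ => (Real.sqrt (-t))⁻¹ • e₀ + (Real.sqrt (1 - t))⁻¹ • e₁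

/-- Drifts are ancient mild solutions of the duality-form class.
[cite: KochNadirashviliSereginSverak2009, §1 p. 3 (parasitic solutions u(x,t) = b(t))] -/
theorem sdrift_isAncientMild (a : ℝ) : IsAncientMildSolution 1 (sdrift a) :=
  isAncientMildSolution_timeConst 1 fun t => (a * (Real.sqrt (-t))⁻¹) • e₀

/-- The perturbed drift is an ancient mild solution of the duality-form class.
[cite: KochNadirashviliSereginSverak2009, §1 p. 3 (parasitic solutions u(x,t) = b(t))] -/
theorem pdrift_isAncientMild : IsAncientMildSolution 1 pdrift :=
  isAncientMildSolution_timeConst 1 fun t => (Real.sqrt (-t))⁻¹ • e₀ + (Real.sqrt (1 - t))⁻¹ • e₁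

/-- `p ↦ (−p.1)^{-1/2}` is smooth on `t < 0`. [folklore] -/
theorem contDiffOn_inv_sqrt_neg :
    ContDiffOn ℝ (⊤ : ℕ∞) (fun p : ℝ × EuclideanSpace ℝ (Fin 3) => (Real.sqrt (-p.1))⁻¹) (Iio 0 ×ˢ univ) := by
  refine ContDiffOn.inv ?_ ?_
  · refine ContDiffOn.sqrt contDiff_fst.neg.contDiffOn ?_
    rintro ⟨t, x⟩ ⟨ht, -⟩
    simp only [mem_Iio] at ht
    exact (neg_pos.2 ht).ne'
  · rintro ⟨t, x⟩ ⟨ht, -⟩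
    simp only [mem_Iio] at ht
    exact (Real.sqrt_pos.2 (neg_pos.2 ht)).ne'

/-- `p ↦ (1 − p.1)^{-1/2}` is smooth on `t < 0`. [folklore] -/
theorem contDiffOn_inv_sqrt_one_sub :
    ContDiffOn ℝ (⊤ : ℕ∞) (fun p : ℝ × EuclideanSpace ℝ (Fin 3) => (Real.sqrt (1 - p.1))⁻¹) (Iio 0 ×ˢ univ) := by
  refine ContDiffOn.inv ?_ ?_
  · refine ContDiffOn.sqrt (contDiff_const.sub contDiff_fst).contDiffOn ?_
    rintro ⟨t, x⟩ ⟨ht, -⟩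
    simp only [mem_Iio] at ht
    show (1 : ℝ) - t ≠ 0
    linarith
  · rintro ⟨t, x⟩ ⟨ht, -⟩
    simp only [mem_Iio] at ht
    exact (Real.sqrt_pos.2 (by show (0 : ℝ) < 1 - t; linarith)).ne'

/-- The drifts are smooth on `t < 0`. [folklore] -/
theorem sdrift_smooth (a : ℝ) : ContDiffOn ℝ (⊤ : ℕ∞) (uncurry (sdrift a)) (Iio 0 ×ˢ univ) :=
  (contDiffOn_const.mul contDiffOn_inv_sqrt_neg).smul contDiffOn_const

/-- The perturbed drift is smooth on `t < 0`. [folklore] -/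
theorem pdrift_smooth : ContDiffOn ℝ (⊤ : ℕ∞) (uncurry pdrift) (Iio 0 ×ˢ univ) :=
  (contDiffOn_inv_sqrt_neg.smul contDiffOn_const).add (contDiffOn_inv_sqrt_one_sub.smul contDiffOn_const)

/-- `‖sdrift a (t, x)‖ = a/√(−t)` for `a ≥ 0`. [folklore] -/
theorem norm_sdrift {a : ℝ} (ha : 0 ≤ a) (t : ℝ) (x : EuclideanSpace ℝ (Fin 3)) :
    ‖sdrift a t x‖ = a * (Real.sqrt (-t))⁻¹ := by
  have hn : ‖e₀‖ = 1 := by simp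
  rw [sdrift, norm_smul, hn, mul_one, Real.norm_eq_abs,
    abs_of_nonneg (mul_nonneg ha (inv_nonneg.2 (Real.sqrt_nonneg _)))]

/-- The drift of temperature `a` has Type-I time decay with every constant `M ≥ a`.
[cite: KochNadirashviliSereginSverak2009, (1.4)] -/
theorem sdrift_typeI {a M : ℝ} (ha : 0 ≤ a) (haM : a ≤ M) : HasTypeITimeDecay M (sdrift a) := by
  intro t _ x
  rw [norm_sdrift ha, div_eq_mul_inv]
  exact mul_le_mul_of_nonneg_right haM (inv_nonneg.2 (Real.sqrt_nonneg _))

/-- The drift of temperature `a ≠ 0` does not vanish. [folklore] -/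
theorem sdrift_nontrivial {a : ℝ} (ha : a ≠ 0) : ¬ ∀ t < 0, ∀ x, sdrift a t x = 0 := by
  intro h
  have key := congr_fun (congr_arg (⇑) (h (-1) (by norm_num) 0)) 0
  simp [sdrift, ha] at key

/-- The perturbed drift has Type-I time decay with constant `2`.
[cite: KochNadirashviliSereginSverak2009, (1.4)] -/
theorem pdrift_typeI : HasTypeITimeDecay 2 pdrift := by
  intro t ht x
  have hn0 : ‖e₀‖ = 1 := by simp
  have hn1 : ‖e₁‖ = 1 := by simp
  have h0 : 0 < Real.sqrt (-t) := Real.sqrt_pos.2 (by linarith)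
  have h1 : Real.sqrt (-t) ≤ Real.sqrt (1 - t) := Real.sqrt_le_sqrt (by linarith)
  have h2 : (Real.sqrt (1 - t))⁻¹ ≤ (Real.sqrt (-t))⁻¹ := inv_anti₀ h0 h1
  calc ‖pdrift t x‖ ≤ ‖(Real.sqrt (-t))⁻¹ • e₀‖ + ‖(Real.sqrt (1 - t))⁻¹ • e₁‖ := norm_add_le _ _
    _ = (Real.sqrt (-t))⁻¹ + (Real.sqrt (1 - t))⁻¹ := by
        rw [norm_smul, norm_smul, hn0, hn1, mul_one, mul_one,
          Real.norm_eq_abs, Real.norm_eq_abs,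
          abs_of_nonneg (inv_nonneg.2 (Real.sqrt_nonneg _)), abs_of_nonneg (inv_nonneg.2 (Real.sqrt_nonneg _))]
    _ ≤ (Real.sqrt (-t))⁻¹ + (Real.sqrt (-t))⁻¹ := by linarith
    _ = 2 / Real.sqrt (-t) := by ring

/-- Zoom of the perturbed drift: `c · pdrift (c² t, c x) = (−t)^{-1/2} e₀ + c (1 − c² t)^{-1/2} e₁` for
`t < 0`, `c > 0`. [cite: KochNadirashviliSereginSverak2009, §1] -/
theorem nsRescale_pdrift {c t : ℝ} (hc : 0 < c) (ht : t < 0) (x : EuclideanSpace ℝ (Fin 3)) :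
    nsRescale c pdrift t x = (Real.sqrt (-t))⁻¹ • e₀ + (c * (Real.sqrt (1 - c ^ 2 * t))⁻¹) • e₁ := by
  rw [nsRescale_apply]
  simp only [pdrift]
  have hs : Real.sqrt (-(c ^ 2 * t)) = c * Real.sqrt (-t) := by
    rw [show -(c ^ 2 * t) = c ^ 2 * (-t) by ring, Real.sqrt_mul (sq_nonneg c), Real.sqrt_sq hc.le]
  have h0 : Real.sqrt (-t) ≠ 0 := (Real.sqrt_pos.2 (by linarith)).ne'
  rw [smul_add, smul_smul, smul_smul, hs, mul_inv, ← mul_assoc, mul_inv_cancel₀ hc.ne', one_mul]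

/-- The perturbed drift EMANATES from the drift in the typed sense (`c_k = 1/(k+1)`): uniformly on all of
`t < 0`, not only on compacts. [cite: KochNadirashviliSereginSverak2009, §1] -/
theorem pdrift_emanates :
    ∃ c : ℕ → ℝ, (∀ k, 0 < c k) ∧ Tendsto c atTop (𝓝 0) ∧
      ∀ K : Set (ℝ × EuclideanSpace ℝ (Fin 3)), IsCompact K → K ⊆ Iio 0 ×ˢ univ →
        TendstoUniformlyOn (fun k z => nsRescale (c k) pdrift z.1 z.2) (uncurry (sdrift 1)) atTop K := by
  refine ⟨fun k => 1 / ((k : ℝ) + 1), fun k => by positivity, tendsto_one_div_add_atTop_nhds_zero_nat,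
    fun K _ hK => ?_⟩
  rw [Metric.tendstoUniformlyOn_iff]
  intro ε hε
  filter_upwards [(tendsto_one_div_add_atTop_nhds_zero_nat.eventually (gt_mem_nhds hε))] with k hk z hz
  have hz0 : z.1 < 0 := (mem_prod.1 (hK hz)).1
  have hc : (0 : ℝ) < 1 / ((k : ℝ) + 1) := by positivity
  rw [nsRescale_pdrift hc hz0]
  simp only [uncurry, sdrift, one_mul]
  have hn1 : ‖e₁‖ = 1 := by simp
  rw [dist_eq_norm, sub_add_cancel_left, norm_neg, norm_smul, hn1, mul_one,
    Real.norm_eq_abs,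
    abs_of_nonneg (mul_nonneg hc.le (inv_nonneg.2 (Real.sqrt_nonneg _)))]
  have h1 : 1 ≤ Real.sqrt (1 - (1 / ((k : ℝ) + 1)) ^ 2 * z.1) := by
    rw [← Real.sqrt_one]
    refine Real.sqrt_le_sqrt ?_
    nlinarith [sq_nonneg (1 / ((k : ℝ) + 1))]
  calc 1 / ((k : ℝ) + 1) * (Real.sqrt (1 - (1 / ((k : ℝ) + 1)) ^ 2 * z.1))⁻¹
      ≤ 1 / ((k : ℝ) + 1) * 1 := by
        refine mul_le_mul_of_nonneg_left ?_ hc.le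
        exact inv_le_one_of_one_le₀ h1
    _ < ε := by rw [mul_one]; exact hk

end ParasiticDrift

open ParasiticDrift

/-- **`HeteroclinicRigidityNS` (card `recycle-track-shoot`, SketchIdeator2) is FALSE as typed.** Junk model:
the parasitic pair `U = (−t)^{-1/2} e₀`, `W = (−t)^{-1/2} e₀ + (1−t)^{-1/2} e₁` at `M = 2`; `W` emanates
from `U` (`pdrift_emanates`) but its `e₁`-coordinate `(1−t₀)^{-1/2} ≠ 0` at an admissible time `t₀`
contradicts `W = γ U(γ²t + τ, γ x + a)`. Repair missed by the witness: space–time decay `HasTypeIDecay`.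
[cite: KochNadirashviliSereginSverak2009, §1 p. 3 (parasitic solutions u(x,t) = b(t))] -/
theorem not_heteroclinicRigidityNS : ¬ heteroclinicRigidityNS := by
  intro hR
  obtain ⟨a, τ, γ, hγ, hW⟩ := hR 2 (sdrift 1) pdrift (sdrift_isAncientMild 1) pdrift_isAncientMild
    (sdrift_smooth 1) pdrift_smooth (sdrift_typeI zero_le_one one_le_two) pdrift_typeI
    (sdrift_nontrivial one_ne_zero) pdrift_emanates
  -- an admissible time: `t₀ ≤ -1` and `γ² t₀ + τ < 0`
  set t₀ : ℝ := min (-1) ((-τ - 1) / γ ^ 2) with ht₀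
  have hγ2 : 0 < γ ^ 2 := by positivity
  have h1 : t₀ ≤ -1 := min_le_left _ _
  have h2 : γ ^ 2 * t₀ + τ < 0 := by
    have h3 : t₀ ≤ (-τ - 1) / γ ^ 2 := min_le_right _ _
    have h4 : γ ^ 2 * t₀ ≤ -τ - 1 := by
      calc γ ^ 2 * t₀ ≤ γ ^ 2 * ((-τ - 1) / γ ^ 2) := mul_le_mul_of_nonneg_left h3 hγ2.le
        _ = -τ - 1 := by field_simp
    linarith
  have key := congr_fun (congr_arg (⇑) (hW t₀ 0 h2)) 1
  -- the `e₁`-coordinate reads `(1 - t₀)^{-1/2} = 0`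
  have lhs : (pdrift t₀ 0) 1 = (Real.sqrt (1 - t₀))⁻¹ := by simp [pdrift]
  have rhs : (γ • sdrift 1 (γ ^ 2 * t₀ + τ) (γ • (0 : EuclideanSpace ℝ (Fin 3)) + a)) 1 = 0 := by
    simp [sdrift]
  rw [lhs, rhs] at key
  have h5 : 0 < Real.sqrt (1 - t₀) := Real.sqrt_pos.2 (by linarith)
  exact (inv_pos.2 h5).ne' key

/-- **`IgnitionWithLossNS` (card `closed-shadow`, SketchIdeator2) is FALSE as typed**: igniting the cold
parasitic drift `(c/4)(−t)^{-1/2} e₀` with loss `η = c/4` yields a Schwartz-data `H¹⁰_df`-mild Navier–Stokes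
Type-I blow-up of ceiling `c/2`, below Leray's floor `c` (`typeI_constant_ge`). Repair missed by the witness:
space–time decay `HasTypeIDecay` (then small-constant Liouville removes cold objects).
[cite: Leray1934, §19 (3.9)] -/
theorem not_ignitionWithLossNS : ¬ ignitionWithLossNS := by
  intro hI
  obtain ⟨c, hc, hfloor⟩ := typeI_constant_ge
  have ha : 0 < c / 4 := by positivity
  obtain ⟨u₀, hdiv, S, hS, u, hu, hrate, hno⟩ :=
    hI (c / 4) (sdrift (c / 4)) (sdrift_isAncientMild _) (sdrift_smooth _) (sdrift_typeI ha.le le_rfl)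
      (sdrift_nontrivial ha.ne') (c / 4) ha
  have h := hfloor (c / 4 + c / 4) u₀ hdiv S hS u hu hrate hno
  linarith

end Summit.NavierStokesRegularity.NavierStokesRegularity.Theorems.BoundedTemperatureClosed.Negative

end
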